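import Summits.KontsevichZagierPeriods.KontsevichZagierPeriods.Theorems.SymplecticScissorsVolumeFormOffPlaneUnionSplit

/-!
# `VolumeFormOffPlane` (stmt-KontsevichZagierPeriods-14935) — line `Sketch`,
stub `stub_weightedOfFamilies` (two-sided family form ⇒ `ℤ`-weighted families)

Pure bookkeeping in the formal group of the Kontsevich–Zagier calculus
(`Literature/NumberTheory/Transcendental/KZCalculus.lean`). The landed sector theorems of the
line have the TWO-SIDED FAMILY shape: for two classes `GB` (boxes) and `GS` (cells) of
representations of dimension `N`, two pairs of finite families in `GB`/`GS` with equal total value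
have congruent formal sums modulo `KZ.relations`. This file upgrades that shape to `ℤ`-WEIGHTED
families: every `ℤ`-combination `∑ cB i • [ρB i] + ∑ cS ν • [ρS ν]` (members in `GB`/`GS` wherever
the coefficient is non-zero) of total weighted value `0` is a relation.

Proof: replicate each member `ρ i` exactly `(c i).toNat` times on the "plus" side and
`(-c i).toNat` times on the "minus" side (`wof_replicate`, indexing the copies by
`Σ i, Fin (n i) ≃ Fin (∑ i, n i)` via `finSigmaFinEquiv`); members with coefficient `0` get no
copies. The value hypothesis of the two-sided property is the cast of
`Int.toNat_sub_toNat_neg : ↑(c.toNat) - ↑((-c).toNat) = c` (`wof_value_identity`), and its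
conclusion rearranges to the weighted sum by the same identity (`wof_formal_identity`).

Sources: folklore (free abelian group bookkeeping); Kontsevich–Zagier 2001, §1.2 for the calculus.
-/

noncomputable section

open MeasureTheory Set
open Literature.NumberTheory.Transcendental

namespace Summit.KontsevichZagierPeriods.SymplecticScissors.LogPolytope

/-- Summing `g i` over `n i` copies of each index `i : Fin k`, the copies being enumerated by
`Fin (∑ i, n i)` through `finSigmaFinEquiv`, gives `∑ i, n i • g i`. [folklore] -/
theorem wof_sum_replicate {M : Type*} [AddCommMonoid M] {k : ℕ} (n : Fin k → ℕ)
    (g : Fin k → M) :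
    ∑ j : Fin (∑ i, n i), g ((finSigmaFinEquiv (n := n)).symm j).1 = ∑ i, n i • g i := by
  calc ∑ j : Fin (∑ i, n i), g ((finSigmaFinEquiv (n := n)).symm j).1
      = ∑ x : (Σ i : Fin k, Fin (n i)), g x.1 :=
        Fintype.sum_equiv (finSigmaFinEquiv (n := n)).symm _ _ fun _ => rfl
    _ = ∑ i, n i • g i := by
        rw [Fintype.sum_sigma]
        exact Finset.sum_congr rfl fun i _ => by simp

/-- **Replication of a family with multiplicities.** Given representations `ρ i` (`i : Fin k`)
with multiplicities `n i : ℕ`, all members of positive multiplicity lying in a class `G`, there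
is a finite family in `G` (the `n i` copies of each `ρ i`) whose total value is
`∑ i, n i * value (ρ i)` and whose formal sum is `∑ i, n i • [ρ i]`. [folklore] -/
theorem wof_replicate {N k : ℕ} (G : KZ.IntegralRep N → Prop) (ρ : Fin k → KZ.IntegralRep N)
    (n : Fin k → ℕ) (hG : ∀ i, n i ≠ 0 → G (ρ i)) :
    ∃ (K : ℕ) (ρ' : Fin K → KZ.IntegralRep N), (∀ j, G (ρ' j)) ∧
      ∑ j, (ρ' j).value = ∑ i, (n i : ℝ) * (ρ i).value ∧
      ∑ j, KZ.of (ρ' j) = ∑ i, (n i : ℤ) • KZ.of (ρ i) := by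
  refine ⟨∑ i, n i, fun j => ρ ((finSigmaFinEquiv (n := n)).symm j).1, fun j => ?_, ?_, ?_⟩
  · exact hG _ (Fin.pos ((finSigmaFinEquiv (n := n)).symm j).2).ne'
  · rw [wof_sum_replicate n (fun i => (ρ i).value)]
    exact Finset.sum_congr rfl fun i _ => nsmul_eq_mul _ _
  · rw [wof_sum_replicate n (fun i => KZ.of (ρ i))]
    exact Finset.sum_congr rfl fun i _ => (natCast_zsmul _ _).symm

/-- If `c : ℤ` has `c.toNat ≠ 0` then `c ≠ 0`. [folklore] -/
theorem wof_ne_zero_of_toNat_ne_zero {c : ℤ} (h : c.toNat ≠ 0) : c ≠ 0 := by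
  omega

/-- If `c : ℤ` has `(-c).toNat ≠ 0` then `c ≠ 0`. [folklore] -/
theorem wof_ne_zero_of_toNat_neg_ne_zero {c : ℤ} (h : (-c).toNat ≠ 0) : c ≠ 0 := by
  omega

/-- **Value bookkeeping.** If the `ℤ`-weighted total value vanishes, the total value of the
"plus" copies equals that of the "minus" copies. [folklore] -/
theorem wof_value_identity {k m : ℕ} (cB : Fin k → ℤ) (cS : Fin m → ℤ) (vB : Fin k → ℝ)
    (vS : Fin m → ℝ) (hval : ∑ i, (cB i : ℝ) * vB i + ∑ ν, (cS ν : ℝ) * vS ν = 0) :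
    ∑ i, (((cB i).toNat : ℕ) : ℝ) * vB i + ∑ ν, (((cS ν).toNat : ℕ) : ℝ) * vS ν =
      ∑ i, (((-cB i).toNat : ℕ) : ℝ) * vB i + ∑ ν, (((-cS ν).toNat : ℕ) : ℝ) * vS ν := by
  have h : (∑ i, (((cB i).toNat : ℕ) : ℝ) * vB i + ∑ ν, (((cS ν).toNat : ℕ) : ℝ) * vS ν) -
      (∑ i, (((-cB i).toNat : ℕ) : ℝ) * vB i + ∑ ν, (((-cS ν).toNat : ℕ) : ℝ) * vS ν) =
      ∑ i, (cB i : ℝ) * vB i + ∑ ν, (cS ν : ℝ) * vS ν := by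
    -- the real cast of `Int.toNat_sub_toNat_neg`: `(c : ℝ) = c.toNat - (-c).toNat`
    have hc : ∀ c : ℤ, (c : ℝ) = ((c.toNat : ℕ) : ℝ) - (((-c).toNat : ℕ) : ℝ) := fun c => by
      have h := congrArg (fun z : ℤ => (z : ℝ)) (Int.toNat_sub_toNat_neg c)
      simp only [Int.cast_sub, Int.cast_natCast] at h
      exact h.symm
    simp only [hc, sub_mul, Finset.sum_sub_distrib]
    ring
  rw [← sub_eq_zero, h, hval]

/-- **Formal bookkeeping.** In an additive commutative group, "plus" copies minus "minus" copies
is the `ℤ`-weighted sum: `∑ (c i).toNat • x i - ∑ (-c i).toNat • x i = ∑ c i • x i`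
(two families at once). [folklore] -/
theorem wof_formal_identity {M : Type*} [AddCommGroup M] {k m : ℕ} (cB : Fin k → ℤ)
    (cS : Fin m → ℤ) (xB : Fin k → M) (xS : Fin m → M) :
    (∑ i, ((cB i).toNat : ℤ) • xB i + ∑ ν, ((cS ν).toNat : ℤ) • xS ν) -
        (∑ i, ((-cB i).toNat : ℤ) • xB i + ∑ ν, ((-cS ν).toNat : ℤ) • xS ν) =
      ∑ i, cB i • xB i + ∑ ν, cS ν • xS ν := by
  have h : ∀ {l : ℕ} (c : Fin l → ℤ) (x : Fin l → M),
      ∑ i, c i • x i = ∑ i, ((c i).toNat : ℤ) • x i - ∑ i, ((-c i).toNat : ℤ) • x i := by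
    intro l c x
    rw [← Finset.sum_sub_distrib]
    refine Finset.sum_congr rfl fun i _ => ?_
    rw [← sub_smul, Int.toNat_sub_toNat_neg]
  rw [h cB xB, h cS xS]
  abel

/-- **ℤ-WEIGHTED FAMILIES from the two-sided family form.** For any two classes `GB`, `GS` of
representations (the boxes and the cells of a sector) with the two-sided family property "equal
total value ⇒ the formal sums are congruent", every `ℤ`-weighted combination of total weighted
value `0` is a relation (replicate each member `|cᵢ|` times on the side of the sign of `cᵢ`;
members with `cᵢ = 0` are unconstrained). Pure bookkeeping. [folklore] -/
theorem stub_weightedOfFamilies : ∀ (N : ℕ) (GB GS : KZ.IntegralRep N → Prop),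
    (∀ (k m k' m' : ℕ) (ρB : Fin k → KZ.IntegralRep N) (ρS : Fin m → KZ.IntegralRep N)
        (ρB' : Fin k' → KZ.IntegralRep N) (ρS' : Fin m' → KZ.IntegralRep N),
      (∀ i, GB (ρB i)) → (∀ ν, GS (ρS ν)) → (∀ i, GB (ρB' i)) → (∀ ν, GS (ρS' ν)) →
      ∑ i, (ρB i).value + ∑ ν, (ρS ν).value = ∑ i, (ρB' i).value + ∑ ν, (ρS' ν).value →
      (∑ i, KZ.of (ρB i) + ∑ ν, KZ.of (ρS ν)) - (∑ i, KZ.of (ρB' i) + ∑ ν, KZ.of (ρS' ν)) ∈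
        KZ.relations) →
    ∀ (k m : ℕ) (ρB : Fin k → KZ.IntegralRep N) (ρS : Fin m → KZ.IntegralRep N)
      (cB : Fin k → ℤ) (cS : Fin m → ℤ),
      (∀ i, cB i ≠ 0 → GB (ρB i)) → (∀ ν, cS ν ≠ 0 → GS (ρS ν)) →
      ∑ i, (cB i : ℝ) * (ρB i).value + ∑ ν, (cS ν : ℝ) * (ρS ν).value = 0 →
      ∑ i, cB i • KZ.of (ρB i) + ∑ ν, cS ν • KZ.of (ρS ν) ∈ KZ.relations := by
  intro N GB GS H k m ρB ρS cB cS hGB hGS hval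
  obtain ⟨Kp, ρBp, hGBp, hvBp, hoBp⟩ := wof_replicate GB ρB (fun i => (cB i).toNat)
    fun i hi => hGB i (wof_ne_zero_of_toNat_ne_zero hi)
  obtain ⟨Km, ρBm, hGBm, hvBm, hoBm⟩ := wof_replicate GB ρB (fun i => (-cB i).toNat)
    fun i hi => hGB i (wof_ne_zero_of_toNat_neg_ne_zero hi)
  obtain ⟨Lp, ρSp, hGSp, hvSp, hoSp⟩ := wof_replicate GS ρS (fun ν => (cS ν).toNat)
    fun ν hν => hGS ν (wof_ne_zero_of_toNat_ne_zero hν)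
  obtain ⟨Lm, ρSm, hGSm, hvSm, hoSm⟩ := wof_replicate GS ρS (fun ν => (-cS ν).toNat)
    fun ν hν => hGS ν (wof_ne_zero_of_toNat_neg_ne_zero hν)
  have hv : ∑ j, (ρBp j).value + ∑ j, (ρSp j).value =
      ∑ j, (ρBm j).value + ∑ j, (ρSm j).value := by
    rw [hvBp, hvSp, hvBm, hvSm]
    exact wof_value_identity cB cS (fun i => (ρB i).value) (fun ν => (ρS ν).value) hval
  have key := H Kp Lp Km Lm ρBp ρSp ρBm ρSm hGBp hGSp hGBm hGSm hv
  rw [hoBp, hoSp, hoBm, hoSm,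
    wof_formal_identity cB cS (fun i => KZ.of (ρB i)) (fun ν => KZ.of (ρS ν))] at key
  exact key

end Summit.KontsevichZagierPeriods.SymplecticScissors.LogPolytope

end
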